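import Mathlib.Data.Finset.Card
import Mathlib.Data.Fintype.Card
import Mathlib.Algebra.Group.Basic
import Mathlib.Tactic.Abel
import Mathlib.Tactic.Ring

/-!
# The pair (label) lemma for pure designs with a common quotient

Solo-informed MatrixMultiplication, gen 87 (CLAIMS c655; `work/g87/cyc/CYC.md` §2).

In the "common quotient" regime of the uniform volume conjecture `(PT)` for pure `𝔽₂` designs, the label sets
`L_t = λ(X_t) ⊆ Λ = G/S` of two blocks `t, u` are `δ`-free (`δ = λ(c_t) + λ(c_u) ≠ 0`, from `(P3)` and `(D)`), and
the cross conditions `(P4)`, `(P4')` forbid the two label sums `v = λ(z_t + z_u)` and `v + δ = λ(y_t + y_u)`.  The purely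
additive-combinatorial core is the following statement about an abelian group of exponent two:

* `two_mul_card_add_card_le_of_pair_free` — if `A`, `B` are finite, no two elements of `A` (resp. of `B`) sum to
  `δ`, and no `a + b` (`a ∈ A`, `b ∈ B`) equals `v` or `v + δ`, then `2 (|A| + |B|) ≤ |G|`.

Proof: `B`, `B + δ`, `A + v`, `A + v + δ` are pairwise disjoint and each translate has the cardinality of its source.
Consequence recorded in `CYC.md`: the two blocks carry volume `T_t + T_u ≤ n/2`; with three cyclically aligned blocks
`T ≤ 3n/4` (tight), and `k ≤ 4` purely aligned blocks never exceed `n`.  Elementary; no `sorry`.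
-/

namespace Summit.MatrixMultiplication.MatrixMultiplication.Theorems.SoloVal

open Finset

section PairLabel

variable {G : Type*} [AddCommGroup G]

/-- In exponent two, `-g = g`. -/
theorem neg_eq_self_of_exponent_two (h2 : ∀ g : G, g + g = 0) (g : G) : -g = g :=
  (eq_neg_of_add_eq_zero_left (h2 g)).symm

/-- In exponent two, `x + g = y ↔ x = y + g`. -/
theorem add_eq_iff_eq_add_of_exponent_two (h2 : ∀ g : G, g + g = 0) (x y g : G) :
    x + g = y ↔ x = y + g := by
  constructor
  · intro h
    calc x = x + g + g := by rw [add_assoc, h2, add_zero]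
      _ = y + g := by rw [h]
  · intro h
    rw [h, add_assoc, h2, add_zero]

variable [DecidableEq G]

/-- THE PAIR LEMMA (label form).  In an abelian group of exponent two let `A`, `B` be finite sets such that no two
elements of `A` sum to `δ`, no two elements of `B` sum to `δ`, and no sum `a + b` (`a ∈ A`, `b ∈ B`) equals `v` or
`v + δ`.  Then `2 (|A| + |B|) ≤ |G|`: the four sets `B`, `B + δ`, `A + v`, `A + v + δ` are pairwise disjoint. -/
theorem two_mul_card_add_card_le_of_pair_free [Fintype G] (h2 : ∀ g : G, g + g = 0) (δ v : G)
    (A B : Finset G) (hA : ∀ a ∈ A, ∀ a' ∈ A, a + a' ≠ δ) (hB : ∀ b ∈ B, ∀ b' ∈ B, b + b' ≠ δ)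
    (hv : ∀ a ∈ A, ∀ b ∈ B, a + b ≠ v) (hv' : ∀ a ∈ A, ∀ b ∈ B, a + b ≠ v + δ) :
    2 * (A.card + B.card) ≤ Fintype.card G := by
  classical
  have hneg : ∀ g : G, -g = g := neg_eq_self_of_exponent_two h2
  -- `x + y = 0 → x = y` in exponent two
  have eq_of_add_eq_zero : ∀ x y : G, x + y = 0 → x = y := by
    intro x y h; rw [eq_neg_of_add_eq_zero_left h, hneg]
  set B' : Finset G := B.image (fun b => b + δ) with hB'def
  set A₁ : Finset G := A.image (fun a => a + v) with hA₁def
  set A₂ : Finset G := A.image (fun a => a + (v + δ)) with hA₂def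
  have hcB' : B'.card = B.card := card_image_of_injective _ (add_left_injective δ)
  have hcA₁ : A₁.card = A.card := card_image_of_injective _ (add_left_injective v)
  have hcA₂ : A₂.card = A.card := card_image_of_injective _ (add_left_injective (v + δ))
  have memB' : ∀ x, x ∈ B' → ∃ b ∈ B, b + δ = x := by
    intro x hx; simpa only [hB'def, mem_image] using hx
  have memA₁ : ∀ x, x ∈ A₁ → ∃ a ∈ A, a + v = x := by
    intro x hx; simpa only [hA₁def, mem_image] using hx
  have memA₂ : ∀ x, x ∈ A₂ → ∃ a ∈ A, a + (v + δ) = x := by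
    intro x hx; simpa only [hA₂def, mem_image] using hx
  -- the six disjointness relations
  have d1 : Disjoint B B' := by
    rw [disjoint_left]; intro x hxB hxB'
    obtain ⟨b, hb, hbx⟩ := memB' x hxB'
    apply hB x hxB b hb
    have e : (b + δ) + b = (b + b) + δ := by abel
    rw [← hbx, e, h2, zero_add]
  have d2 : Disjoint A₁ A₂ := by
    rw [disjoint_left]; intro x hx1 hx2
    obtain ⟨a, ha, hax⟩ := memA₁ x hx1
    obtain ⟨a', ha', ha'x⟩ := memA₂ x hx2
    apply hA a ha a' ha'
    have e : (a + v) + (a' + (v + δ)) = ((a + a') + δ) + (v + v) := by abel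
    rw [hax, ha'x, h2 x, h2 v, add_zero] at e
    exact eq_of_add_eq_zero _ _ e.symm
  have d3 : Disjoint B A₁ := by
    rw [disjoint_left]; intro x hxB hx1
    obtain ⟨a, ha, hax⟩ := memA₁ x hx1
    apply hv a ha x hxB
    have e : a + (a + v) = (a + a) + v := by abel
    rw [← hax, e, h2, zero_add]
  have d4 : Disjoint B A₂ := by
    rw [disjoint_left]; intro x hxB hx2
    obtain ⟨a, ha, hax⟩ := memA₂ x hx2
    apply hv' a ha x hxB
    have e : a + (a + (v + δ)) = (a + a) + (v + δ) := by abel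
    rw [← hax, e, h2, zero_add]
  have d5 : Disjoint B' A₁ := by
    rw [disjoint_left]; intro x hxB' hx1
    obtain ⟨b, hb, hbx⟩ := memB' x hxB'
    obtain ⟨a, ha, hax⟩ := memA₁ x hx1
    apply hv' a ha b hb
    have e : (a + v) + (b + δ) = ((a + b) + (v + δ)) := by abel
    rw [hax, hbx, h2 x] at e
    exact eq_of_add_eq_zero _ _ e.symm
  have d6 : Disjoint B' A₂ := by
    rw [disjoint_left]; intro x hxB' hx2
    obtain ⟨b, hb, hbx⟩ := memB' x hxB'
    obtain ⟨a, ha, hax⟩ := memA₂ x hx2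
    apply hv a ha b hb
    have e : (a + (v + δ)) + (b + δ) = ((a + b) + v) + (δ + δ) := by abel
    rw [hax, hbx, h2 x, h2 δ, add_zero] at e
    exact eq_of_add_eq_zero _ _ e.symm
  -- count
  have hBB : (B ∪ B').card = B.card + B.card := by rw [card_union_of_disjoint d1, hcB']
  have hAA : (A₁ ∪ A₂).card = A.card + A.card := by rw [card_union_of_disjoint d2, hcA₁, hcA₂]
  have dU : Disjoint (B ∪ B') (A₁ ∪ A₂) :=
    disjoint_union_left.2 ⟨disjoint_union_right.2 ⟨d3, d4⟩, disjoint_union_right.2 ⟨d5, d6⟩⟩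
  have hU : ((B ∪ B') ∪ (A₁ ∪ A₂)).card = 2 * (A.card + B.card) := by
    rw [card_union_of_disjoint dU, hBB, hAA]; ring
  calc 2 * (A.card + B.card) = ((B ∪ B') ∪ (A₁ ∪ A₂)).card := hU.symm
    _ ≤ Fintype.card G := card_le_univ _

/-- Symmetric packaging used in `CYC.md`: with `|A| = |L_t|`, `|B| = |L_u|` label sets of two blocks in the common
quotient `Λ`, the pair lemma reads `|L_t| + |L_u| ≤ |Λ| / 2`. -/
theorem card_add_card_le_half_of_pair_free [Fintype G] (h2 : ∀ g : G, g + g = 0) (δ v : G)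
    (A B : Finset G) (hA : ∀ a ∈ A, ∀ a' ∈ A, a + a' ≠ δ) (hB : ∀ b ∈ B, ∀ b' ∈ B, b + b' ≠ δ)
    (hv : ∀ a ∈ A, ∀ b ∈ B, a + b ≠ v) (hv' : ∀ a ∈ A, ∀ b ∈ B, a + b ≠ v + δ) :
    A.card + B.card ≤ Fintype.card G / 2 := by
  have h := two_mul_card_add_card_le_of_pair_free h2 δ v A B hA hB hv hv'
  omega

end PairLabel

end Summit.MatrixMultiplication.MatrixMultiplication.Theorems.SoloVal
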